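import Mathlib
import HarnessLib
import Summits.Ventures.LatticeQCDFlow.Scoring.SplitChainDependsOn
import Summits.Ventures.LatticeQCDFlow.Exactness.NCMCGeneralSpaceDoeblinPowerPoisson

/-!
# Decorrelation of the past from the future under a Doeblin POWER, from any start: `|E[G (φ(X_{u+w}) − πφ)]| ≤ 2 C_φ (1 − ε)^{⌊w/m⌋} E|G|` and the pair form `|E[G (g₁(X_{u+w}) g₂(X_{u+w+k}) − E_π g₁(X_0)g₂(X_k))]| ≤ 2 C_{g₁} C_{g₂} (1 − ε)^{⌊w/m⌋} E|G|`

HONEST FRAMING: exact (Metropolis-corrected) sampling algorithms for lattice gauge theory;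
figures of merit are autocorrelation/cost numbers at stated couplings and volumes; no
continuum-physics claim.

Venture `LatticeQCDFlow` (cell pub-lqcd), topic `Exactness`; FANOUT row 13 (`eng-snf`, GEN-20).
NEW WORK of the cell, not a published result; no definition is introduced; nothing is cited as a
fact (φ-mixing of uniformly ergodic chains — Ibragimov 1962, Bradley 2005 §3 — NAMED ONLY).  Row 8
proved the decorrelation of a past functional from one or two future observations under a ONE-step
minorisation `κ(x, ·) ≥ ε ν` through the residual-kernel structure of `(kop κ)^[w]`
(`Scoring/ChainBlockDecorrelation.lean`).  The iteration kernel of the engine's NCMC lane is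
minorised only in TWO steps (GEN-18 `NCMCGeneralSpaceOccupancyChainDoeblin`), and every composite
sampler of the cell certifies a POWER.  This file proves the same decorrelation under an `m`-step
minorisation `(nHit κ m)(x, ·) ≥ ε ν` by the shorter sup-norm route: the `t`-step tower property in
`DependsOn` form (row 8's `Scoring.chain_tower_iterate_dependsOn`, any Markov kernel) and the sup-norm
bias `|(kop κ)^[t] g − πg| ≤ 2 C_g (1 − ε)^{⌊t/m⌋}` (GEN-18's `doeblin_integral_nHit_sub_le_of_nHit`,
rescaled).  It is the covariance input of the consistency of the Γ-method (windowed autocovariance)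
estimator of the asymptotic variance along the chain (`NCMCGeneralSpaceLagProductMoments.lean`,
`NCMCGeneralSpaceGammaMethodConsistency.lean`).

## Content (`κ` Markov on `S`, `π` invariant, `(nHit κ m)(x, ·) ≥ ε ν`, `ε ≤ 1`; `P_{μ₀}` the chain's
## path law `Kernel.trajMeasure` from ANY initial law `μ₀`; observables bounded measurable)

* **`abs_iterate_kop_sub_integral_le_of_nHit`** — `|(kop κ)^[t] g x − ∫ g dπ| ≤ 2 C_g (1 − ε)^{⌊t/m⌋}`
  for EVERY bounded measurable `g` (not only centred ones), every `x`, `t`.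
* **`chain_dependsOn_centredFuture_le_of_nHit`** — for `G` bounded measurable with
  `DependsOn G (Set.Iic u)`: `|∫ G · (φ(X_{u+w}) − πφ) dP_{μ₀}| ≤ 2 C_φ (1 − ε)^{⌊w/m⌋} ∫ |G| dP_{μ₀}`;
  `chain_bias_signed_le_of_nHit` (`|E_{μ₀} φ(X_t) − πφ| ≤ 2 C_φ (1 − ε)^{⌊t/m⌋}`, signed observables);
  **`chain_dependsOn_future_cov_le_of_nHit`** — the covariance form
  `|E[G φ(X_{u+w})] − E[G] E[φ(X_{u+w})]| ≤ 4 C_φ (1 − ε)^{⌊w/m⌋} ∫ |G|`.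
* `dependsOn_mul_apply`, **`chain_tower_pair_dependsOn`** — `E[G g₁(X_v) g₂(X_{v+k})] =
  E[G (g₁ · (kop κ)^[k] g₂)(X_v)]` for `DependsOn G (Set.Iic v)` (any Markov kernel);
  **`chain_dependsOn_centredFuturePair_le_of_nHit`** — with `φ_k = g₁ · (kop κ)^[k] g₂`:
  `|∫ G · (g₁(X_{u+w}) g₂(X_{u+w+k}) − πφ_k) dP_{μ₀}| ≤ 2 C_{g₁} C_{g₂} (1 − ε)^{⌊w/m⌋} ∫ |G|`.

The second moments of centred block sums and of lag products built on these lemmas are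
`NCMCGeneralSpaceLagProductMoments.lean`.

NOT CLAIMED: total-variation / φ-mixing statements as such; sharp constants; unbounded observables.
-/

namespace Summit.Ventures.LatticeQCDFlow.Exactness.GeneralNCMC

open MeasureTheory ProbabilityTheory Set Filter Finset
open scoped ENNReal Topology

variable {S : Type*} [MeasurableSpace S]

section Power

variable {κ : Kernel S S} [IsMarkovKernel κ] {ν : Measure S} [IsProbabilityMeasure ν] {ε : ℝ≥0∞}
  {π : Measure S} [IsProbabilityMeasure π] {m : ℕ}

/-- **Sup-norm bias under a Doeblin power, signed observables**: if `(nHit κ m)(x, ·) ≥ ε ν`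
(`ε ≤ 1`) and `π` is invariant, then `|(kop κ)^[t] g x − ∫ g dπ| ≤ 2 C_g (1 − ε)^{⌊t/m⌋}` for every
bounded measurable `g` (`|g| ≤ C_g`), every `x` and every `t`. -/
theorem abs_iterate_kop_sub_integral_le_of_nHit
    (hmin : ∀ x {B : Set S}, MeasurableSet B → ε * ν B ≤ nHit κ m x B) (hε1 : ε ≤ 1)
    (hπ : Kernel.Invariant κ π) {g : S → ℝ} (hg : Measurable g) {Cg : ℝ} (hCg : ∀ x, |g x| ≤ Cg)
    (t : ℕ) (x : S) :
    |(Scoring.kop κ)^[t] g x - ∫ y, g y ∂π| ≤ 2 * Cg * (1 - ε.toReal) ^ (t / m) := by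
  haveI := isMarkovKernel_nHit κ t
  rw [iterate_kop_eq_integral_nHit hg hCg t x]
  rcases le_or_gt Cg 0 with hC | hC
  · have hg' : ∀ y, g y = 0 := fun y => abs_nonpos_iff.1 ((hCg y).trans hC)
    have hCg0 : Cg = 0 := le_antisymm hC ((abs_nonneg _).trans (hCg x))
    simp [hg', hCg0]
  · set g' : S → ℝ := fun y => (g y + Cg) / (2 * Cg) with hg'
    have hg'm : Measurable g' := (hg.add_const _).div_const _
    have h0 : ∀ y, 0 ≤ g' y := fun y => by
      rw [hg']
      exact div_nonneg (by linarith [neg_abs_le (g y), hCg y]) (by linarith)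
    have h1 : ∀ y, g' y ≤ 1 := fun y => by
      rw [hg', div_le_one (by linarith)]
      linarith [le_abs_self (g y), hCg y]
    have hresc : ∀ (μ : Measure S) [IsProbabilityMeasure μ],
        ∫ y, g y ∂μ = 2 * Cg * ∫ y, g' y ∂μ - Cg := by
      intro μ _
      rw [hg']
      simp_rw [div_eq_inv_mul]
      rw [integral_const_mul, integral_add (Scoring.integrable_of_bounded μ hg hCg)
        (integrable_const _), integral_const, probReal_univ, one_smul]
      field_simp
      ring
    have hb := doeblin_integral_nHit_sub_le_of_nHit hmin hε1 hπ x t hg'm h0 h1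
    rw [hresc (nHit κ t x), hresc π,
      show 2 * Cg * ∫ y, g' y ∂(nHit κ t x) - Cg - (2 * Cg * ∫ y, g' y ∂π - Cg)
        = 2 * Cg * (∫ y, g' y ∂(nHit κ t x) - ∫ y, g' y ∂π) by ring, abs_mul,
      abs_of_pos (by linarith : (0 : ℝ) < 2 * Cg)]
    exact mul_le_mul_of_nonneg_left hb (by linarith)

variable (μ₀ : Measure S) [IsProbabilityMeasure μ₀]

/-- **THE PAST AND ONE CENTRED FUTURE OBSERVATION, FROM ANY START.**  `(nHit κ m)(x, ·) ≥ ε ν`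
(`ε ≤ 1`), `π` invariant, `G` bounded measurable with `DependsOn G (Set.Iic u)`, `|φ| ≤ C_φ`
measurable: `|∫ G · (φ(X_{u+w}) − ∫ φ dπ) dP_{μ₀}| ≤ 2 C_φ (1 − ε)^{⌊w/m⌋} ∫ |G| dP_{μ₀}`. -/
theorem chain_dependsOn_centredFuture_le_of_nHit
    (hmin : ∀ x {B : Set S}, MeasurableSet B → ε * ν B ≤ nHit κ m x B) (hε1 : ε ≤ 1)
    (hπ : Kernel.Invariant κ π) (u w : ℕ) {G : (ℕ → S) → ℝ}
    (hG : Measurable G) (hGd : DependsOn G (Set.Iic u)) {CG : ℝ} (hCG : ∀ x, |G x| ≤ CG)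
    {φ : S → ℝ} (hφ : Measurable φ) {Cφ : ℝ} (hCφ : ∀ x, |φ x| ≤ Cφ) :
    |∫ x, G x * (φ (x (u + w)) - ∫ y, φ y ∂π) ∂(Kernel.trajMeasure (X := fun _ : ℕ => S) μ₀
        (fun n : ℕ => κ.comap (fun h : (i : ↥(Finset.Iic n)) → S => h ⟨n, Finset.mem_Iic.2 le_rfl⟩)
          (measurable_pi_apply _)))|
      ≤ 2 * Cφ * (1 - ε.toReal) ^ (w / m) * ∫ x, |G x| ∂(Kernel.trajMeasure (X := fun _ : ℕ => S) μ₀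
        (fun n : ℕ => κ.comap (fun h : (i : ↥(Finset.Iic n)) → S => h ⟨n, Finset.mem_Iic.2 le_rfl⟩)
          (measurable_pi_apply _))) := by
  set P := Kernel.trajMeasure (X := fun _ : ℕ => S) μ₀
      (fun n : ℕ => κ.comap (fun h : (i : ↥(Finset.Iic n)) → S => h ⟨n, Finset.mem_Iic.2 le_rfl⟩)
        (measurable_pi_apply _)) with hP
  have hCG0 : 0 ≤ CG := (abs_nonneg _).trans (hCG (Classical.choice
    (nonempty_of_isProbabilityMeasure P)))
  have hCφ0 : 0 ≤ Cφ := (abs_nonneg _).trans (hCφ (Classical.choice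
    (nonempty_of_isProbabilityMeasure μ₀)))
  obtain ⟨hKm, hKb⟩ := Scoring.iterate_kop_bounded_measurable κ hφ hCφ w
  -- tower: `E[G φ(X_{u+w})] = E[G (K^w φ)(X_u)]`
  have h1 := Scoring.chain_tower_iterate_dependsOn κ μ₀ u w hG hGd hCG hφ hCφ
  rw [← hP] at h1
  have hiG : Integrable G P := Scoring.integrable_of_bounded P hG hCG
  have hiGφ : Integrable (fun x : ℕ → S => G x * φ (x (u + w))) P :=
    Scoring.integrable_of_bounded P (hG.mul (hφ.comp (measurable_pi_apply _))) (C := CG * Cφ)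
      fun x => by rw [abs_mul]; exact mul_le_mul (hCG x) (hCφ _) (abs_nonneg _) hCG0
  have hiGK : Integrable (fun x : ℕ → S => G x * (Scoring.kop κ)^[w] φ (x u)) P :=
    Scoring.integrable_of_bounded P (hG.mul (hKm.comp (measurable_pi_apply _))) (C := CG * Cφ)
      fun x => by rw [abs_mul]; exact mul_le_mul (hCG x) (hKb _) (abs_nonneg _) hCG0
  have hsplit : ∫ x, G x * (φ (x (u + w)) - ∫ y, φ y ∂π) ∂P
      = ∫ x, G x * ((Scoring.kop κ)^[w] φ (x u) - ∫ y, φ y ∂π) ∂P := by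
    have e1 : (fun x : ℕ → S => G x * (φ (x (u + w)) - ∫ y, φ y ∂π))
        = fun x => G x * φ (x (u + w)) - G x * ∫ y, φ y ∂π := by funext x; ring
    have e2 : (fun x : ℕ → S => G x * ((Scoring.kop κ)^[w] φ (x u) - ∫ y, φ y ∂π))
        = fun x => G x * (Scoring.kop κ)^[w] φ (x u) - G x * ∫ y, φ y ∂π := by funext x; ring
    rw [e1, e2, integral_sub hiGφ (hiG.mul_const _), integral_sub hiGK (hiG.mul_const _), h1]
  rw [hsplit]
  calc |∫ x, G x * ((Scoring.kop κ)^[w] φ (x u) - ∫ y, φ y ∂π) ∂P|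
      ≤ ∫ x, |G x * ((Scoring.kop κ)^[w] φ (x u) - ∫ y, φ y ∂π)| ∂P := abs_integral_le_integral_abs
    _ ≤ ∫ x, 2 * Cφ * (1 - ε.toReal) ^ (w / m) * |G x| ∂P := by
        refine integral_mono_of_nonneg (ae_of_all _ fun x => abs_nonneg _)
          (hiG.abs.const_mul _) (ae_of_all _ fun x => ?_)
        show |G x * ((Scoring.kop κ)^[w] φ (x u) - ∫ y, φ y ∂π)|
          ≤ 2 * Cφ * (1 - ε.toReal) ^ (w / m) * |G x|
        rw [abs_mul, mul_comm]
        exact mul_le_mul_of_nonneg_right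
          (abs_iterate_kop_sub_integral_le_of_nHit hmin hε1 hπ hφ hCφ w (x u)) (abs_nonneg _)
    _ = 2 * Cφ * (1 - ε.toReal) ^ (w / m) * ∫ x, |G x| ∂P := integral_const_mul _ _

/-- **Certified burn-in for signed observables, any start**: `|E_{μ₀} φ(X_t) − ∫ φ dπ| ≤
2 C_φ (1 − ε)^{⌊t/m⌋}`. -/
theorem chain_bias_signed_le_of_nHit
    (hmin : ∀ x {B : Set S}, MeasurableSet B → ε * ν B ≤ nHit κ m x B) (hε1 : ε ≤ 1)
    (hπ : Kernel.Invariant κ π) {φ : S → ℝ} (hφ : Measurable φ) {Cφ : ℝ} (hCφ : ∀ x, |φ x| ≤ Cφ)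
    (t : ℕ) :
    |∫ x, φ (x t) ∂(Kernel.trajMeasure (X := fun _ : ℕ => S) μ₀
        (fun n : ℕ => κ.comap (fun h : (i : ↥(Finset.Iic n)) → S => h ⟨n, Finset.mem_Iic.2 le_rfl⟩)
          (measurable_pi_apply _))) - ∫ y, φ y ∂π| ≤ 2 * Cφ * (1 - ε.toReal) ^ (t / m) := by
  set P := Kernel.trajMeasure (X := fun _ : ℕ => S) μ₀
      (fun n : ℕ => κ.comap (fun h : (i : ↥(Finset.Iic n)) → S => h ⟨n, Finset.mem_Iic.2 le_rfl⟩)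
        (measurable_pi_apply _)) with hP
  have h := chain_dependsOn_centredFuture_le_of_nHit μ₀ hmin hε1 hπ 0 t (G := fun _ => (1 : ℝ))
    measurable_const ((dependsOn_const (1 : ℝ)).mono (Set.empty_subset _)) (CG := 1)
    (fun _ => by simp) hφ hCφ
  rw [← hP] at h
  simp only [one_mul, Nat.zero_add, abs_one, integral_const, probReal_univ, smul_eq_mul,
    mul_one] at h
  have hiφ : Integrable (fun x : ℕ → S => φ (x t)) P :=
    Scoring.integrable_of_bounded P (hφ.comp (measurable_pi_apply _)) fun x => hCφ _
  rwa [integral_sub hiφ (integrable_const _), integral_const, probReal_univ, one_smul] at h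

/-- **The covariance form**: `|E[G φ(X_{u+w})] − E[G] E[φ(X_{u+w})]| ≤ 4 C_φ (1 − ε)^{⌊w/m⌋} ∫ |G|`. -/
theorem chain_dependsOn_future_cov_le_of_nHit
    (hmin : ∀ x {B : Set S}, MeasurableSet B → ε * ν B ≤ nHit κ m x B) (hε1 : ε ≤ 1)
    (hπ : Kernel.Invariant κ π) (u w : ℕ) {G : (ℕ → S) → ℝ}
    (hG : Measurable G) (hGd : DependsOn G (Set.Iic u)) {CG : ℝ} (hCG : ∀ x, |G x| ≤ CG)
    {φ : S → ℝ} (hφ : Measurable φ) {Cφ : ℝ} (hCφ : ∀ x, |φ x| ≤ Cφ) :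
    |∫ x, G x * φ (x (u + w)) ∂(Kernel.trajMeasure (X := fun _ : ℕ => S) μ₀
        (fun n : ℕ => κ.comap (fun h : (i : ↥(Finset.Iic n)) → S => h ⟨n, Finset.mem_Iic.2 le_rfl⟩)
          (measurable_pi_apply _)))
      - (∫ x, G x ∂(Kernel.trajMeasure (X := fun _ : ℕ => S) μ₀
        (fun n : ℕ => κ.comap (fun h : (i : ↥(Finset.Iic n)) → S => h ⟨n, Finset.mem_Iic.2 le_rfl⟩)
          (measurable_pi_apply _))))
        * ∫ x, φ (x (u + w)) ∂(Kernel.trajMeasure (X := fun _ : ℕ => S) μ₀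
        (fun n : ℕ => κ.comap (fun h : (i : ↥(Finset.Iic n)) → S => h ⟨n, Finset.mem_Iic.2 le_rfl⟩)
          (measurable_pi_apply _)))|
      ≤ 4 * Cφ * (1 - ε.toReal) ^ (w / m) * ∫ x, |G x| ∂(Kernel.trajMeasure (X := fun _ : ℕ => S) μ₀
        (fun n : ℕ => κ.comap (fun h : (i : ↥(Finset.Iic n)) → S => h ⟨n, Finset.mem_Iic.2 le_rfl⟩)
          (measurable_pi_apply _))) := by
  set P := Kernel.trajMeasure (X := fun _ : ℕ => S) μ₀
      (fun n : ℕ => κ.comap (fun h : (i : ↥(Finset.Iic n)) → S => h ⟨n, Finset.mem_Iic.2 le_rfl⟩)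
        (measurable_pi_apply _)) with hP
  have hCG0 : 0 ≤ CG := (abs_nonneg _).trans (hCG (Classical.choice
    (nonempty_of_isProbabilityMeasure P)))
  have hr0 : 0 ≤ 1 - ε.toReal :=
    sub_nonneg.2 (ENNReal.toReal_le_of_le_ofReal zero_le_one (by simpa using hε1))
  have hr1 : 1 - ε.toReal ≤ 1 := sub_le_self _ ENNReal.toReal_nonneg
  set a : ℝ := ∫ y, φ y ∂π with ha
  have hA := chain_dependsOn_centredFuture_le_of_nHit μ₀ hmin hε1 hπ u w hG hGd hCG hφ hCφ
  have hB := chain_bias_signed_le_of_nHit μ₀ hmin hε1 hπ hφ hCφ (u + w)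
  rw [← hP] at hA hB
  have hiG : Integrable G P := Scoring.integrable_of_bounded P hG hCG
  have hiGφ : Integrable (fun x : ℕ → S => G x * φ (x (u + w))) P :=
    Scoring.integrable_of_bounded P (hG.mul (hφ.comp (measurable_pi_apply _))) (C := CG * Cφ)
      fun x => by rw [abs_mul]; exact mul_le_mul (hCG x) (hCφ _) (abs_nonneg _) hCG0
  -- algebra: `E[Gφ] − E[G]E[φ] = E[G(φ − a)] − E[G](E[φ] − a)`
  have hsplit : ∫ x, G x * φ (x (u + w)) ∂P - (∫ x, G x ∂P) * ∫ x, φ (x (u + w)) ∂P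
      = ∫ x, G x * (φ (x (u + w)) - a) ∂P - (∫ x, G x ∂P) * (∫ x, φ (x (u + w)) ∂P - a) := by
    have e1 : (fun x : ℕ → S => G x * (φ (x (u + w)) - a))
        = fun x => G x * φ (x (u + w)) - G x * a := by funext x; ring
    rw [e1, integral_sub hiGφ (hiG.mul_const _), integral_mul_const]
    ring
  rw [hsplit]
  have hI0 : 0 ≤ ∫ x, |G x| ∂P := integral_nonneg fun x => abs_nonneg _
  have hEG : |∫ x, G x ∂P| ≤ ∫ x, |G x| ∂P := abs_integral_le_integral_abs
  -- the bias at time `u + w` is at most the bias at lag `w`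
  have hpow : (1 - ε.toReal) ^ ((u + w) / m) ≤ (1 - ε.toReal) ^ (w / m) :=
    pow_le_pow_of_le_one hr0 hr1 (Nat.div_le_div_right (Nat.le_add_left w u))
  have hCφ0 : 0 ≤ Cφ := (abs_nonneg _).trans (hCφ (Classical.choice
    (nonempty_of_isProbabilityMeasure μ₀)))
  have hB' : |∫ x, φ (x (u + w)) ∂P - a| ≤ 2 * Cφ * (1 - ε.toReal) ^ (w / m) :=
    hB.trans (mul_le_mul_of_nonneg_left hpow (by positivity))
  have hprod : |(∫ x, G x ∂P) * (∫ x, φ (x (u + w)) ∂P - a)|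
      ≤ (∫ x, |G x| ∂P) * (2 * Cφ * (1 - ε.toReal) ^ (w / m)) := by
    rw [abs_mul]; exact mul_le_mul hEG hB' (abs_nonneg _) hI0
  calc |∫ x, G x * (φ (x (u + w)) - a) ∂P - (∫ x, G x ∂P) * (∫ x, φ (x (u + w)) ∂P - a)|
      ≤ |∫ x, G x * (φ (x (u + w)) - a) ∂P| + |(∫ x, G x ∂P) * (∫ x, φ (x (u + w)) ∂P - a)| :=
        abs_sub _ _
    _ ≤ 2 * Cφ * (1 - ε.toReal) ^ (w / m) * ∫ x, |G x| ∂P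
        + (∫ x, |G x| ∂P) * (2 * Cφ * (1 - ε.toReal) ^ (w / m)) := add_le_add hA hprod
    _ = 4 * Cφ * (1 - ε.toReal) ^ (w / m) * ∫ x, |G x| ∂P := by ring

end Power

/-! ## Two future times -/

section Pair

variable {κ : Kernel S S} [IsMarkovKernel κ] (μ₀ : Measure S) [IsProbabilityMeasure μ₀]

omit [MeasurableSpace S] in
/-- A functional of the past up to `v` times an observation at time `v` depends on times `≤ v`. -/
theorem dependsOn_mul_apply {G : (ℕ → S) → ℝ} {u v : ℕ} (hGd : DependsOn G (Set.Iic u))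
    (huv : u ≤ v) (g : S → ℝ) : DependsOn (fun x : ℕ → S => G x * g (x v)) (Set.Iic v) := by
  intro x y hxy
  have h1 : G x = G y := hGd fun i hi => hxy i (Set.mem_Iic.2 ((Set.mem_Iic.1 hi).trans huv))
  have h2 : x v = y v := hxy v (Set.mem_Iic.2 le_rfl)
  simp only [h1, h2]

/-- **Tower property for a future pair** (any Markov kernel): for `G` bounded measurable with
`DependsOn G (Set.Iic v)` and bounded measurable `g₁, g₂`,
`E[G g₁(X_v) g₂(X_{v+k})] = E[G (g₁ · (kop κ)^[k] g₂)(X_v)]`. -/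
theorem chain_tower_pair_dependsOn (v k : ℕ) {G : (ℕ → S) → ℝ} (hG : Measurable G)
    (hGd : DependsOn G (Set.Iic v)) {CG : ℝ} (hCG : ∀ x, |G x| ≤ CG)
    {g₁ g₂ : S → ℝ} (hg₁ : Measurable g₁) {C₁ : ℝ} (hC₁ : ∀ x, |g₁ x| ≤ C₁)
    (hg₂ : Measurable g₂) {C₂ : ℝ} (hC₂ : ∀ x, |g₂ x| ≤ C₂) :
    ∫ x, G x * (g₁ (x v) * g₂ (x (v + k))) ∂(Kernel.trajMeasure (X := fun _ : ℕ => S) μ₀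
        (fun n : ℕ => κ.comap (fun h : (i : ↥(Finset.Iic n)) → S => h ⟨n, Finset.mem_Iic.2 le_rfl⟩)
          (measurable_pi_apply _)))
      = ∫ x, G x * (g₁ (x v) * (Scoring.kop κ)^[k] g₂ (x v))
        ∂(Kernel.trajMeasure (X := fun _ : ℕ => S) μ₀
        (fun n : ℕ => κ.comap (fun h : (i : ↥(Finset.Iic n)) → S => h ⟨n, Finset.mem_Iic.2 le_rfl⟩)
          (measurable_pi_apply _))) := by
  have hCG0 : 0 ≤ CG := (abs_nonneg _).trans (hCG (Classical.choice
    (nonempty_of_isProbabilityMeasure (Kernel.trajMeasure (X := fun _ : ℕ => S) μ₀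
      (fun n : ℕ => κ.comap (fun h : (i : ↥(Finset.Iic n)) → S => h ⟨n, Finset.mem_Iic.2 le_rfl⟩)
        (measurable_pi_apply _))))))
  have h := Scoring.chain_tower_iterate_dependsOn κ μ₀ v k (G := fun x : ℕ → S => G x * g₁ (x v))
    (hG.mul (hg₁.comp (measurable_pi_apply _))) (dependsOn_mul_apply hGd le_rfl g₁)
    (CG := CG * C₁) (fun x => by
      rw [abs_mul]; exact mul_le_mul (hCG x) (hC₁ _) (abs_nonneg _) hCG0) hg₂ hC₂
  simp only [mul_assoc] at h
  exact h

variable {ν : Measure S} [IsProbabilityMeasure ν] {ε : ℝ≥0∞} {π : Measure S} [IsProbabilityMeasure π]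
  {m : ℕ}

/-- **THE PAST AND A CENTRED FUTURE PAIR, FROM ANY START.**  With `φ_k = g₁ · (kop κ)^[k] g₂` (so
that `∫ φ_k dπ = E_π[g₁(X_0) g₂(X_k)]`), for `G` bounded measurable with `DependsOn G (Set.Iic u)`:
`|∫ G · (g₁(X_{u+w}) g₂(X_{u+w+k}) − ∫ φ_k dπ) dP_{μ₀}| ≤ 2 C_{g₁} C_{g₂} (1 − ε)^{⌊w/m⌋} ∫ |G| dP_{μ₀}`. -/
theorem chain_dependsOn_centredFuturePair_le_of_nHit
    (hmin : ∀ x {B : Set S}, MeasurableSet B → ε * ν B ≤ nHit κ m x B) (hε1 : ε ≤ 1)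
    (hπ : Kernel.Invariant κ π) (u w k : ℕ) {G : (ℕ → S) → ℝ}
    (hG : Measurable G) (hGd : DependsOn G (Set.Iic u)) {CG : ℝ} (hCG : ∀ x, |G x| ≤ CG)
    {g₁ g₂ : S → ℝ} (hg₁ : Measurable g₁) {C₁ : ℝ} (hC₁ : ∀ x, |g₁ x| ≤ C₁)
    (hg₂ : Measurable g₂) {C₂ : ℝ} (hC₂ : ∀ x, |g₂ x| ≤ C₂) :
    |∫ x, G x * (g₁ (x (u + w)) * g₂ (x (u + w + k))
        - ∫ y, g₁ y * (Scoring.kop κ)^[k] g₂ y ∂π) ∂(Kernel.trajMeasure (X := fun _ : ℕ => S) μ₀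
        (fun n : ℕ => κ.comap (fun h : (i : ↥(Finset.Iic n)) → S => h ⟨n, Finset.mem_Iic.2 le_rfl⟩)
          (measurable_pi_apply _)))|
      ≤ 2 * (C₁ * C₂) * (1 - ε.toReal) ^ (w / m) * ∫ x, |G x|
        ∂(Kernel.trajMeasure (X := fun _ : ℕ => S) μ₀
        (fun n : ℕ => κ.comap (fun h : (i : ↥(Finset.Iic n)) → S => h ⟨n, Finset.mem_Iic.2 le_rfl⟩)
          (measurable_pi_apply _))) := by
  set P := Kernel.trajMeasure (X := fun _ : ℕ => S) μ₀
      (fun n : ℕ => κ.comap (fun h : (i : ↥(Finset.Iic n)) → S => h ⟨n, Finset.mem_Iic.2 le_rfl⟩)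
        (measurable_pi_apply _)) with hP
  have hCG0 : 0 ≤ CG := (abs_nonneg _).trans (hCG (Classical.choice
    (nonempty_of_isProbabilityMeasure P)))
  have hC₁0 : 0 ≤ C₁ := (abs_nonneg _).trans (hC₁ (Classical.choice
    (nonempty_of_isProbabilityMeasure μ₀)))
  obtain ⟨hKm, hKb⟩ := Scoring.iterate_kop_bounded_measurable κ hg₂ hC₂ k
  -- the one-point observable `φ_k = g₁ · K^k g₂`
  have hφm : Measurable fun y => g₁ y * (Scoring.kop κ)^[k] g₂ y := hg₁.mul hKm
  have hφb : ∀ y, |g₁ y * (Scoring.kop κ)^[k] g₂ y| ≤ C₁ * C₂ := fun y => by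
    rw [abs_mul]; exact mul_le_mul (hC₁ y) (hKb y) (abs_nonneg _) hC₁0
  -- future dependence: `G` depends on `≤ u ≤ u + w`
  have hGd' : DependsOn G (Set.Iic (u + w)) := hGd.mono (Set.Iic_subset_Iic.2 (Nat.le_add_right u w))
  have htower := chain_tower_pair_dependsOn μ₀ (κ := κ) (u + w) k hG hGd' hCG hg₁ hC₁ hg₂ hC₂
  rw [← hP] at htower
  have hiG : Integrable G P := Scoring.integrable_of_bounded P hG hCG
  have hi1 : Integrable (fun x : ℕ → S => G x * (g₁ (x (u + w)) * g₂ (x (u + w + k)))) P :=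
    Scoring.integrable_of_bounded P (hG.mul ((hg₁.comp (measurable_pi_apply _)).mul
      (hg₂.comp (measurable_pi_apply _)))) (C := CG * (C₁ * C₂)) fun x => by
        rw [abs_mul, abs_mul]
        exact mul_le_mul (hCG x) (mul_le_mul (hC₁ _) (hC₂ _) (abs_nonneg _) hC₁0)
          (mul_nonneg (abs_nonneg _) (abs_nonneg _)) hCG0
  have hi2 : Integrable (fun x : ℕ → S => G x * (g₁ (x (u + w)) * (Scoring.kop κ)^[k] g₂ (x (u + w)))) P :=
    Scoring.integrable_of_bounded P (hG.mul (hφm.comp (measurable_pi_apply _))) (C := CG * (C₁ * C₂))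
      fun x => by rw [abs_mul]; exact mul_le_mul (hCG x) (hφb _) (abs_nonneg _) hCG0
  have hred : ∫ x, G x * (g₁ (x (u + w)) * g₂ (x (u + w + k))
        - ∫ y, g₁ y * (Scoring.kop κ)^[k] g₂ y ∂π) ∂P
      = ∫ x, G x * (g₁ (x (u + w)) * (Scoring.kop κ)^[k] g₂ (x (u + w))
        - ∫ y, g₁ y * (Scoring.kop κ)^[k] g₂ y ∂π) ∂P := by
    have e1 : (fun x : ℕ → S => G x * (g₁ (x (u + w)) * g₂ (x (u + w + k))
        - ∫ y, g₁ y * (Scoring.kop κ)^[k] g₂ y ∂π))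
        = fun x => G x * (g₁ (x (u + w)) * g₂ (x (u + w + k)))
          - G x * ∫ y, g₁ y * (Scoring.kop κ)^[k] g₂ y ∂π := by funext x; ring
    have e2 : (fun x : ℕ → S => G x * (g₁ (x (u + w)) * (Scoring.kop κ)^[k] g₂ (x (u + w))
        - ∫ y, g₁ y * (Scoring.kop κ)^[k] g₂ y ∂π))
        = fun x => G x * (g₁ (x (u + w)) * (Scoring.kop κ)^[k] g₂ (x (u + w)))
          - G x * ∫ y, g₁ y * (Scoring.kop κ)^[k] g₂ y ∂π := by funext x; ring
    rw [e1, e2, integral_sub hi1 (hiG.mul_const _), integral_sub hi2 (hiG.mul_const _), htower]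
  rw [hred]
  have h := chain_dependsOn_centredFuture_le_of_nHit μ₀ hmin hε1 hπ u w hG hGd hCG hφm hφb
  rw [← hP] at h
  exact h

end Pair


end Summit.Ventures.LatticeQCDFlow.Exactness.GeneralNCMC
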